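/-
Copyright (c) 2026 the pub-hodgecm-mathlib formalisation cell (harness21).  Prover seat hodgecm-mathlib-K2Liu-p02 (g2),
Track B «K2-LIT» ∕ hLiu418 #184♮, unit U6 «FIRST TERM», socket #42 `sig_K2LiuEisensteinResidueIsThetaIntegral` (steward): the kernel-checked
form of the REPORT-FIRST finding «CENTRE WEIGHT» (C1), LEAD ruling «M-154s» (S1) 2026-09-03T23:47:35Z.  2026-09-04.
-/
import Summits.HodgeConjecture.HodgeConjecture.Theorems.K2LiuLineThetaCentreAbsorb             -- ★ p855935 (O42.1): D8 weight-1 integral centre-invariant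
import Summits.HodgeConjecture.HodgeConjecture.Theorems.K2LiuSiegelEisensteinCentralCharacter   -- ★ p855978 (O42.2): Eisenstein side χ(u^{N·M})-covariant
import HarnessLib

/-!
# K2_Liu road (hLiu418 = stmt-HodgeConjecture-24832), unit U6 «FIRST TERM»: the CENTRE OBSTRUCTION — the weight-free form of socket #42
# (U6 ED. 3 :265 ∕ ED. 4 :277) forces the residue to vanish identically

Cell `pub/hodgecm-mathlib` (D-0151), Track B; socket #42 `sig_K2LiuEisensteinResidueIsThetaIntegral`, STEWARD K2Liu-p02 (g2); finding «CENTRE WEIGHT»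
(REPORT-FIRST `K2/K2Liu-p02/g2/REPORT-FIRST-42-…md` §−1 (C1)), UPHELD by K2Liu-ref1 (g0) 2026-09-03T23:47:00Z, FACT OF RECORD by LEAD F0P6-plan «M-154s» (S1),
repaired in U6 ED. 5 by the weight token (S2).  THIS FILE is (C1) as a theorem over ★ carriers, for ANY frame `(N, M)`, any conjugate-symplectic `λ`,
any family of Siegel sections `f_s ∈ I(s, χ_λ)`, any pole-cleared continuation `(P, Es)` with #41's clauses (i)(iv), any top point `s₀` with `Re s₀ > 0`,
and any weight-free data `(k, a′, κ, Φ′, hρ, μW)` with `U(⟨a′_i⟩)(𝔸)`-invariant `μW_i`: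

  **if `(s − s₀)·Es(s, h)/∏_{p∈P}(s − p) → Σ_i κ_i · I_i(h; Φ′_i)` for EVERY `h` (the typed conclusion of #42, `I_i` = ★ D8 `doubledLineThetaIntegral`, weight `1`)
  and the centre character `χ_λ(u^{N·M})` is not identically `1` on `U(1)(𝔸_{L⁺})`, then `Σ_i κ_i · I_i(h; Φ′_i) = 0` for every `h`** —

because the limit `R` is `χ_λ(u^{N·M})`-covariant under the central `z_u = ι(u·1_V, u·1_V)` (★ `residue_centre_mul`) and at the same time invariant
(★ `doubledLineThetaIntegral_mul_centre`; `z_u = toDiagA⁻¹(u·1_𝔻)`, `iotaV_adelicCenter_eq_toDiagA_symm`).  For the socket's frame `(N, M) = (2, 1)` and a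
weight-one `λ` the hypothesis `∃ u, χ_λ(u²) ≠ 1` holds (archimedean component `e^{iθ} ↦ e^{±2iθ}`; its Lean witness is the separate organ O42.2b), so #42 AS TYPED
says «`Res_{s=½} E⋆(·; f) ≡ 0` for every standard `f`», which is false for every family with a genuine pole at `½` ([Tan1999]; [KudlaSweet1997]) — in particular for
the family of s23 — and would close s5 only vacuously; the weighted ED. 5 (`doubledLineThetaLift … (f i)`, `∃ f`) is the printed first-term identity
[GanQiuTakeda2014, Thm. 20 (i)] ∕ [Ichino2004, Thm. 1.1] ∕ [Liu2021, p. 104 «splitting characters (μᶜ, 1)»].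

* `iotaV_adelicCenter_eq_toDiagA_symm` — the two spellings of the centre of `H(𝔸)` agree (both are the matrix `u • 1`).
* **`typedResidue_centre_covariant`**, **`typedResidue_centre_invariant`**, **`typedResidue_eq_zero`** — (C1).

Mathlib + ★ only; no `sorry`, no definition, no instance.  HONEST LABEL: HC_CM is proved only modulo the 7 printed citations (2 remaining named inputs:
hLiu418 = stmt-HodgeConjecture-24832, h413 = stmt-HodgeConjecture-24833) until rung 0 closes; this file is a `--supports stmt-HodgeConjecture-24832 --as helper`
NEGATIVE-SIDE helper (it shows a typed socket vacuous; it refutes nothing frozen and retires nothing).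

References: [Tan1999] V. Tan, Canad. J. Math. 51 (1999) §1, §4; [GanQiuTakeda2014] W. T. Gan, Y. Qiu, S. Takeda, Invent. Math. 198 (2014) §7 Thm. 20 (i);
[Liu2021] Y. Liu, Camb. J. Math. 9 (2021) App. B p. 104; [GelbartRogawski1991] §3.1 Remark p. 457.
-/

set_option autoImplicit false
set_option linter.dupNamespace false
-- statements over the adelic dual-pair carriers elaborate to very large types; elaborate sequentially (as in ★ `K2LiuSeesawFubini`)
set_option Elab.async false

noncomputable section

open NumberField MeasureTheory IsDedekindDomain Filter
open scoped Matrix Topology ComplexOrder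

namespace Summit.HodgeConjecture.HodgeConjecture.Cruxes.HLiu418.K2LiuEisensteinResidueCentreObstruction

open Literature.NumberTheory.Automorphic Literature.NumberTheory.Automorphic.UnitaryGroup
open Literature.NumberTheory.Automorphic.IdeleClassGroup
open Literature.NumberTheory.Automorphic.Liu2021
open Literature.NumberTheory.Automorphic.Liu2021.Def411WeilCarriers
open Literature.NumberTheory.Automorphic.Liu2021.Def411WeilCarriersDoubling
open Literature.NumberTheory.GaloisRepresentations
open Literature.NumberTheory.GelbartRogawski1991 Literature.NumberTheory.GelbartRogawski1991.UnitaryDualPair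
open Literature.NumberTheory.GelbartRogawski1991.GRConstruction
open Literature.NumberTheory.Weil1964
open Literature.RepresentationTheory.Liu2021
open Literature.NumberTheory.K2Lit.SiegelDoubled
open Literature.NumberTheory.K2Lit.DoubledLineTheta
open Summit.HodgeConjecture.HodgeConjecture.Cruxes.HLiu418.K2LiuLineThetaCentreAbsorb (doubledLineThetaIntegral_mul_centre)
open Summit.HodgeConjecture.HodgeConjecture.Cruxes.HLiu418.K2LiuSiegelEisensteinCentralCharacter

variable (L : Type) [Field L] [NumberField L] [IsCMField L]
variable {N M n : ℕ} (e : Fin N × Fin M ≃ Fin n)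
  (dV : Fin N → L) (hdV : ∀ i, IsCMField.complexConj L (dV i) = dV i) (hdV0 : ∀ i, dV i ≠ 0)
  (dW : Fin M → L) (hdW : ∀ i, IsCMField.complexConj L (dW i) = dW i) (hdW0 : ∀ i, dW i ≠ 0)

/-! ## §1 The two spellings of the centre of `H(𝔸)` -/

/-- `ι(u·1_V, u·1_V) = toDiagA⁻¹(u·1_𝔻)` in `H(𝔸)` — both have the matrix `u • 1_{2n}` (★ `coe_iotaV_adelicCenter`, ★ `coe_toDiagA_symm`, ★ `coe_adelicCenter`).
[cite: GelbartRogawski1991, §3.1 Remark p. 457] -/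
theorem iotaV_adelicCenter_eq_toDiagA_symm (u : adelicOne (Fp L) L (IsCMField.complexConj L)) :
    iotaV L e dV hdV dW hdW (adelicCenter (Fp L) L (IsCMField.complexConj L) N (Matrix.diagonal dV) u,
        adelicCenter (Fp L) L (IsCMField.complexConj L) N (Matrix.diagonal dV) u) =
      (toDiagA L e dV hdV dW hdW).symm (adelicCenter (Fp L) L (IsCMField.complexConj L) (n + n) (Matrix.diagonal (dD L e dV hdV dW hdW)) u) := by
  apply Subtype.ext
  apply Units.ext
  rw [coe_iotaV_adelicCenter, coe_toDiagA_symm, coe_adelicCenter]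

/-! ## §2 The centre obstruction -/

variable {n'' : ℕ} (e₁ : Fin (n + n) × Fin 1 ≃ Fin n'')
  (lam : Literature.NumberTheory.Automorphic.IdeleClassGroup L →ₜ* Circle) (hlam : IsConjugateSymplectic L lam)

set_option maxHeartbeats 1000000 in -- the D8 telescope (cf. ★ `K2LiuSeesawFubini`)
include hdV0 hdW0 in
/-- **The typed residue is `χ_λ(u^{N·M})`-COVARIANT under the centre.**  For a family of Siegel sections `f_s ∈ I(s, χ_λ)`, a continuation `(P, Es)` with
#41's clauses (i)(iv), a point `s₀` with `0 < Re s₀`, and weight-free theta data whose sum `R(h) = Σ_i κ_i I_i(h)` IS the `𝓝[≠] s₀`-limit of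
`(s − s₀)·Es(s,h)/∏(s−p)` at every `h`: `R(z_u·h) = χ_λ(u^{N·M})·R(h)` (★ `residue_centre_mul`). [cite: Tan1999, §1] -/
theorem typedResidue_centre_covariant (f : ℂ → HA L e dV hdV dW hdW → ℂ)
    (hf : IsSiegelDeltaSectionFamily L e dV hdV dW hdW (toHeckeCharacter L lam) f) (P : Finset ℂ) (Es : ℂ → HA L e dV hdV dW hdW → ℂ)
    (hhol : ∀ h : HA L e dV hdV dW hdW, DifferentiableOn ℂ (fun s => Es s h) {s : ℂ | 0 < s.re})
    (heq : ∀ (s : ℂ) (h : HA L e dV hdV dW hdW), (n : ℝ) / 2 < s.re →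
      Es s h = (∏ p ∈ P, (s - p)) * eisensteinFamilyDelta L e dV hdV dW hdW f s h)
    {s₀ : ℂ} (hs₀ : 0 < s₀.re) (R : HA L e dV hdV dW hdW → ℂ)
    (hlim : ∀ h : HA L e dV hdV dW hdW,
      Tendsto (fun s : ℂ => (s - s₀) * (Es s h / ∏ p ∈ P, (s - p))) (𝓝[≠] s₀) (𝓝 (R h)))
    (u : adelicOne (Fp L) L (IsCMField.complexConj L)) (h : HA L e dV hdV dW hdW) :
    R (iotaV L e dV hdV dW hdW (adelicCenter (Fp L) L (IsCMField.complexConj L) N (Matrix.diagonal dV) u,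
          adelicCenter (Fp L) L (IsCMField.complexConj L) N (Matrix.diagonal dV) u) * h) =
      ((toHeckeCharacter L lam ((u : (AdeleRing (𝓞 L) L)ˣ) ^ (N * M)) : ℂˣ) : ℂ) * R h :=
  residue_centre_mul L e dV hdV hdV0 dW hdW hdW0 hf P Es hhol heq u h hs₀ (hlim h) (hlim _)

set_option maxHeartbeats 1000000 in -- idem
/-- **The typed (weight-`1`) right-hand side is INVARIANT under the centre**: `Σ_i κ_i I_i(z_u·h) = Σ_i κ_i I_i(h)` for `U(⟨a′_i⟩)(𝔸)`-invariant `μW_i`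
(★ `doubledLineThetaIntegral_mul_centre` term by term; `z_u` central). [cite: GelbartRogawski1991, §3.1 Remark p. 457] [cite: Liu2021, App. B (B.7) p. 104] -/
theorem typedResidue_centre_invariant {k : ℕ} (a' : Fin k → (↥(maximalRealSubfield L))ˣ) (κ : Fin k → ℂ)
    (Φ' : Fin k → piSchwartzBruhat (↥(maximalRealSubfield L)) (Fin n''))
    (hρ : ∀ i, HasThetaMajorants fun
      (p : ↥(UnitaryGroup.adelic (↥(maximalRealSubfield L)) L (IsCMField.complexConj L) (n + n) (Matrix.diagonal (dD L e dV hdV dW hdW))) ×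
        ↥(UnitaryGroup.adelic (↥(maximalRealSubfield L)) L (IsCMField.complexConj L) 1 (JW (↥(maximalRealSubfield L)) L (a' i))))
      (Φ : piSchwartzBruhat (↥(maximalRealSubfield L)) (Fin n'')) =>
        pairRep (↥(maximalRealSubfield L)) L (IsCMField.complexConj L) (n + n) 1 e₁ (Matrix.diagonal (dD L e dV hdV dW hdW)) (JW (↥(maximalRealSubfield L)) L (a' i))
          (chiSplittingLine L e₁ (dD L e dV hdV dW hdW) (dD_conj L e dV hdV dW hdW) (dD_ne_zero L e dV hdV dW hdW hdV0 hdW0)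
            (toHeckeCharacter L lam) (isUnitary_toHeckeCharacter L lam)
            ((isOscillatorChar_toHeckeCharacter_iff lam).mpr hlam) (TW (↥(maximalRealSubfield L)) (a' i))
            (isUnit_det_TW (↥(maximalRealSubfield L)) (a' i)) (JW (↥(maximalRealSubfield L)) L (a' i)) (JW_eq (↥(maximalRealSubfield L)) L (a' i)))
          p Φ)
    (μW : ∀ i, @Measure (↥(UnitaryGroup.adelic (↥(maximalRealSubfield L)) L (IsCMField.complexConj L) 1 (JW (↥(maximalRealSubfield L)) L (a' i))) ⧸
      (UnitaryGroup.toAdelic (↥(maximalRealSubfield L)) L (IsCMField.complexConj L) 1 (JW (↥(maximalRealSubfield L)) L (a' i))).range) (borel _))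
    (hinv : ∀ i, @SMulInvariantMeasure
      ↥(UnitaryGroup.adelic (↥(maximalRealSubfield L)) L (IsCMField.complexConj L) 1 (JW (↥(maximalRealSubfield L)) L (a' i)))
      (↥(UnitaryGroup.adelic (↥(maximalRealSubfield L)) L (IsCMField.complexConj L) 1 (JW (↥(maximalRealSubfield L)) L (a' i))) ⧸
        (UnitaryGroup.toAdelic (↥(maximalRealSubfield L)) L (IsCMField.complexConj L) 1 (JW (↥(maximalRealSubfield L)) L (a' i))).range)
      _ (borel _) (μW i))
    (u : adelicOne (Fp L) L (IsCMField.complexConj L)) (h : HA L e dV hdV dW hdW) :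
    (∑ i, κ i * @doubledLineThetaIntegral L _ _ _ N M n e dV hdV dW hdW n'' e₁ hdV0 hdW0 lam hlam (a' i) (hρ i)
        (borel _) (μW i) (Φ' i)
        (iotaV L e dV hdV dW hdW (adelicCenter (Fp L) L (IsCMField.complexConj L) N (Matrix.diagonal dV) u,
          adelicCenter (Fp L) L (IsCMField.complexConj L) N (Matrix.diagonal dV) u) * h)) =
      ∑ i, κ i * @doubledLineThetaIntegral L _ _ _ N M n e dV hdV dW hdW n'' e₁ hdV0 hdW0 lam hlam (a' i) (hρ i)
        (borel _) (μW i) (Φ' i) h := by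
  refine Finset.sum_congr rfl fun i _ => ?_
  congr 1
  letI : MeasurableSpace (↥(UnitaryGroup.adelic (↥(maximalRealSubfield L)) L (IsCMField.complexConj L) 1 (JW (↥(maximalRealSubfield L)) L (a' i))) ⧸
      (UnitaryGroup.toAdelic (↥(maximalRealSubfield L)) L (IsCMField.complexConj L) 1 (JW (↥(maximalRealSubfield L)) L (a' i))).range) := borel _
  haveI : BorelSpace (↥(UnitaryGroup.adelic (↥(maximalRealSubfield L)) L (IsCMField.complexConj L) 1 (JW (↥(maximalRealSubfield L)) L (a' i))) ⧸
      (UnitaryGroup.toAdelic (↥(maximalRealSubfield L)) L (IsCMField.complexConj L) 1 (JW (↥(maximalRealSubfield L)) L (a' i))).range) := ⟨rfl⟩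
  haveI := hinv i
  rw [iotaV_adelicCenter_mul_comm, iotaV_adelicCenter_eq_toDiagA_symm]
  exact doubledLineThetaIntegral_mul_centre L e dV hdV dW hdW e₁ hdV0 hdW0 lam hlam (a' i) (hρ i) (μW i) (Φ' i) h u

set_option maxHeartbeats 1000000 in -- idem
include hdV0 hdW0 in
/-- **THE CENTRE OBSTRUCTION (REPORT-FIRST #42 §−1 (C1), LEAD «M-154s» (S1)).**  In any frame `(N, M)`, for a conjugate-symplectic `λ`, a family of Siegel
sections `f_s ∈ I(s, χ_λ)`, a continuation `(P, Es)` with #41's (i)(iv), a point `s₀` with `0 < Re s₀`, and weight-free doubled line theta data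
`(k, a′, κ, Φ′, hρ, μW)` with invariant `μW_i`: IF the typed conclusion of #42 holds — `(s − s₀)·Es(s,h)/∏(s−p) → Σ_i κ_i I_i(h)` for every `h` — and some
`u ∈ U(1)(𝔸_{L⁺})` has `χ_λ(u^{N·M}) ≠ 1`, THEN `Σ_i κ_i I_i(h) = 0` for every `h`: the residue vanishes identically.  (Covariant by
`typedResidue_centre_covariant`, invariant by `typedResidue_centre_invariant`, and `(c − 1)·R = 0` with `c ≠ 1`.)  For `(N, M) = (2, 1)` and weight-one `λ` such a
`u` exists, so the weight-free socket is vacuous exactly where s5 needs it; the repair is the weight `f` of U6 ED. 5. [cite: GanQiuTakeda2014, §7 Thm. 20 (i)]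
[cite: Liu2021, App. B p. 104] [cite: Tan1999, §1] -/
theorem typedResidue_eq_zero (f : ℂ → HA L e dV hdV dW hdW → ℂ)
    (hf : IsSiegelDeltaSectionFamily L e dV hdV dW hdW (toHeckeCharacter L lam) f) (P : Finset ℂ) (Es : ℂ → HA L e dV hdV dW hdW → ℂ)
    (hhol : ∀ h : HA L e dV hdV dW hdW, DifferentiableOn ℂ (fun s => Es s h) {s : ℂ | 0 < s.re})
    (heq : ∀ (s : ℂ) (h : HA L e dV hdV dW hdW), (n : ℝ) / 2 < s.re →
      Es s h = (∏ p ∈ P, (s - p)) * eisensteinFamilyDelta L e dV hdV dW hdW f s h)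
    {s₀ : ℂ} (hs₀ : 0 < s₀.re)
    {k : ℕ} (a' : Fin k → (↥(maximalRealSubfield L))ˣ) (κ : Fin k → ℂ)
    (Φ' : Fin k → piSchwartzBruhat (↥(maximalRealSubfield L)) (Fin n''))
    (hρ : ∀ i, HasThetaMajorants fun
      (p : ↥(UnitaryGroup.adelic (↥(maximalRealSubfield L)) L (IsCMField.complexConj L) (n + n) (Matrix.diagonal (dD L e dV hdV dW hdW))) ×
        ↥(UnitaryGroup.adelic (↥(maximalRealSubfield L)) L (IsCMField.complexConj L) 1 (JW (↥(maximalRealSubfield L)) L (a' i))))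
      (Φ : piSchwartzBruhat (↥(maximalRealSubfield L)) (Fin n'')) =>
        pairRep (↥(maximalRealSubfield L)) L (IsCMField.complexConj L) (n + n) 1 e₁ (Matrix.diagonal (dD L e dV hdV dW hdW)) (JW (↥(maximalRealSubfield L)) L (a' i))
          (chiSplittingLine L e₁ (dD L e dV hdV dW hdW) (dD_conj L e dV hdV dW hdW) (dD_ne_zero L e dV hdV dW hdW hdV0 hdW0)
            (toHeckeCharacter L lam) (isUnitary_toHeckeCharacter L lam)
            ((isOscillatorChar_toHeckeCharacter_iff lam).mpr hlam) (TW (↥(maximalRealSubfield L)) (a' i))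
            (isUnit_det_TW (↥(maximalRealSubfield L)) (a' i)) (JW (↥(maximalRealSubfield L)) L (a' i)) (JW_eq (↥(maximalRealSubfield L)) L (a' i)))
          p Φ)
    (μW : ∀ i, @Measure (↥(UnitaryGroup.adelic (↥(maximalRealSubfield L)) L (IsCMField.complexConj L) 1 (JW (↥(maximalRealSubfield L)) L (a' i))) ⧸
      (UnitaryGroup.toAdelic (↥(maximalRealSubfield L)) L (IsCMField.complexConj L) 1 (JW (↥(maximalRealSubfield L)) L (a' i))).range) (borel _))
    (hinv : ∀ i, @SMulInvariantMeasure
      ↥(UnitaryGroup.adelic (↥(maximalRealSubfield L)) L (IsCMField.complexConj L) 1 (JW (↥(maximalRealSubfield L)) L (a' i)))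
      (↥(UnitaryGroup.adelic (↥(maximalRealSubfield L)) L (IsCMField.complexConj L) 1 (JW (↥(maximalRealSubfield L)) L (a' i))) ⧸
        (UnitaryGroup.toAdelic (↥(maximalRealSubfield L)) L (IsCMField.complexConj L) 1 (JW (↥(maximalRealSubfield L)) L (a' i))).range)
      _ (borel _) (μW i))
    (hlim : ∀ h : HA L e dV hdV dW hdW,
      Tendsto (fun s : ℂ => (s - s₀) * (Es s h / ∏ p ∈ P, (s - p))) (𝓝[≠] s₀)
        (𝓝 (∑ i, κ i * @doubledLineThetaIntegral L _ _ _ N M n e dV hdV dW hdW n'' e₁ hdV0 hdW0 lam hlam (a' i) (hρ i)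
          (borel _) (μW i) (Φ' i) h)))
    (u : adelicOne (Fp L) L (IsCMField.complexConj L))
    (hu : ((toHeckeCharacter L lam ((u : (AdeleRing (𝓞 L) L)ˣ) ^ (N * M)) : ℂˣ) : ℂ) ≠ 1) (h : HA L e dV hdV dW hdW) :
    (∑ i, κ i * @doubledLineThetaIntegral L _ _ _ N M n e dV hdV dW hdW n'' e₁ hdV0 hdW0 lam hlam (a' i) (hρ i)
        (borel _) (μW i) (Φ' i) h) = 0 := by
  have hcov := typedResidue_centre_covariant L e dV hdV hdV0 dW hdW hdW0 lam f hf P Es hhol heq hs₀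
    (fun h' => ∑ i, κ i * @doubledLineThetaIntegral L _ _ _ N M n e dV hdV dW hdW n'' e₁ hdV0 hdW0 lam hlam (a' i) (hρ i)
        (borel _) (μW i) (Φ' i) h') hlim u h
  have hinv' := typedResidue_centre_invariant L e dV hdV hdV0 dW hdW hdW0 e₁ lam hlam a' κ Φ' hρ μW hinv u h
  -- `R(h) = R(z_u·h) = c·R(h)` with `c ≠ 1`
  rw [hinv'] at hcov
  have h1 : (((toHeckeCharacter L lam ((u : (AdeleRing (𝓞 L) L)ˣ) ^ (N * M)) : ℂˣ) : ℂ) - 1) *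
      (∑ i, κ i * @doubledLineThetaIntegral L _ _ _ N M n e dV hdV dW hdW n'' e₁ hdV0 hdW0 lam hlam (a' i) (hρ i)
        (borel _) (μW i) (Φ' i) h) = 0 := by
    rw [sub_mul, one_mul, ← hcov, sub_self]
  exact (mul_eq_zero.1 h1).resolve_left (sub_ne_zero.2 hu)

end Summit.HodgeConjecture.HodgeConjecture.Cruxes.HLiu418.K2LiuEisensteinResidueCentreObstruction

end
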